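import Mathlib
import Literature.NumberTheory.Transcendental.PeriodsWave0
import Literature.NumberTheory.Transcendental.ZetaLinearFormsCriterion
import Literature.NumberTheory.Irrationality.LaiZhou2022.OddZetaAndBetaRecords
import HarnessLib

/-!
# Rivoal–Zudilin 2020: at least two of `ζ(5), ζ(7), …, ζ(69)` are irrational

Topic `Literature/NumberTheory/Irrationality/RivoalZudilin2020`. Source (read on the page this session, arXiv text
`1803.03160`): T. Rivoal, W. Zudilin, *A note on odd zeta values*, Sém. Lothar. Combin. **81** (2020), Art. B81b,
13 pp. [RivoalZudilin2020]. Section numbers below are those of the paper.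

HONEST FRAMING (cells pub-zeta5 / zeta5-irr): the paper proves that TWO of the 33 numbers `ζ(5), …, ζ(69)` are
irrational, without locating them; it says nothing about `ζ(5)` itself. This file types the statements as printed
(vocabulary with bodies; NAMED FACTS `proposition1_i`, `proposition1_ii`, `proposition3`, `log_phi_div_tendsto`,
`theorem1`) and PROVES: the elementary equivalence of Theorems 1 and 2 (§1), the identity `ζ̂(s) = (2^s − 1) ζ(s)`,
and the whole of §6 — Theorem 2, hence Theorem 1, from the four named facts and the prime number theorem
(`theorem2_of_propositions`, `theorem1_of_propositions`).

## What is printed and what is typed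

* **§2 Notations.** For an integer `A ≥ 15` and `n ≥ 0`,
  `R(t) := n!^{A−15} 2^{18n} (2t + n) (t − n)_n^3 (t + n + 1)_n^3 (t − n + ½)_{3n}^3 / (t)_{n+1}^A`,
  `(x)_m := x(x+1)⋯(x+m−1)` (`rfun`); its partial fraction expansion
  `R(t) = Σ_{j=1}^{A} Σ_{m=0}^{n} p_{j,m}/(t+m)^j` (2) with
  `p_{j,m} := (1/(A−j)!) (R(t)(t+m)^A)^{(A−j)}|_{t=−m} ∈ ℚ` (3) (`pCoeff`, through the function `R(t)(t+m)^A` with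
  the pole at `−m` cancelled, `rfunReg`);
  `S_n := Σ_{k≥1} R''(k)`, `Ŝ_n := Σ_{k≥1} R''(k − ½)` (`S`, `Shat`).
* **Proposition 1** (§3; `A ≥ 16` and `n ≥ 0` both even). "(i) `S_n = q_{0,n} + Σ_{j odd, 5≤j≤A+1} q_{j,n} ζ(j)`
  (6) and `Ŝ_n = q̂_{0,n} + Σ_{j odd, 5≤j≤A+1} q_{j,n} (2^j − 1) ζ(j)` (7), where `q_{0,n}`, `q̂_{0,n}` and the
  `q_{j,n}` are rational numbers, that depend on `A`. (ii) Let `d_n := lcm{1, 2, …, n}` and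
  `Φ_n := Π_{2√n < p ≤ n} p^{ρ₀(n/p)}` (Phi_n). Then `Φ_n^{−3} d_n^{A+2}` is a common denominator of `q_{0,n}`,
  `q̂_{0,n}` and the `q_{j,n}` for odd `j ≥ 5`." The
  explicit expressions of the proof are the typed DEFINITIONS: `q_{j,n} := Σ_m (j−2)(j−1) p_{j−2,m}` (10) (`qCoeff`),
  `q_{0,n} := −Σ_{j,m} Σ_{k=1}^{m} j(j+1) p_{j,m}/k^{j+2}` (11) (`qZero`),
  `q̂_{0,n} := −Σ_{j,m} Σ_{k=1}^{m} j(j+1) p_{j,m}/(k − ½)^{j+2}` (8) (`qZeroHat`);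
  `ρ(x,y) := ⌊2x+2y⌋ + ⌊4x−2y⌋ − 6⌊y⌋ − 6⌊x−y⌋` (`rho`) and `ρ₀(x) := min_y ρ(x,y)`, "explicitly given on `0 ≤ x < 1`
  by `0, 1, 2, 3, 4` on `[0,⅓), [⅓,½), [½,⅔), [⅔,⅚), [⅚,1)`" — `rho0` is DEFINED by this table (the `min`
  characterisation is not typed). NAMED FACTS `proposition1_i` (the identities (6), (7) with these `q`'s) and
  `proposition1_ii` (integrality of `Φ_n^{−3} d_n^{A+2} q`).
* `ζ̂(s) := Σ_{k≥1} (k − ½)^{−s} = (2^s − 1) ζ(s)` (§3): PROVED, `zetaHat_eq`.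
* **Proposition 2** (§4, complex integral representations of `S_n`, `Ŝ_n`): not typed.
* **Proposition 3** (§5, `A = 68`). "There exists an increasing sequence of even integers `σ(n)` such that
  `lim |S_{σ(n)}|^{1/σ(n)} = lim |Ŝ_{σ(n)}|^{1/σ(n)} = e^{−κ}` with `κ ≈ 66.1727`, and `lim Ŝ_{σ(n)}/S_{σ(n)} = −1`."
  NAMED FACT `proposition3`; `κ` (`= −log|f(t₂)e^{4iπt₂}|` at the saddle point `t₂ ≈ 1.0004 − 0.0007i`) is typed by
  the printed approximation as `66.17 < κ < 66.18`.
* **§6.** "`lim log(d_n)/n = 1` and `δ := lim log(Φ_n)/n = ∫₀¹ ρ₀(t) d(ψ(t) + t^{−1}) ≈ 1.29564`" (prime number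
  theorem; `ψ = Γ'/Γ`). The first is in the tree (`Chebyshev.psi_eq_log_lcmUpto` + `chebyshevPsi_isEquivalent_holds`);
  the second is the NAMED FACT `log_phi_div_tendsto` (existence of the limit with `1.2956 < δ < 1.2957`; the
  digamma integral is not typed). Then, with `A = 68`, for odd `m ∈ {5, …, 69}` and even `n`,
  `Φ_n^{−3} d_n^{70} ((2^m − 1) S_n − Ŝ_n) = Q_{0,n} + Σ_{j odd ≠ m} Q_{j,n} ζ(j)` with integer `Q`'s and
  `|…|^{1/σ(n)} → e^{70 − κ − 3δ} ≈ e^{−0.0597} < 1`. This assembly is PROVED (`theorem2_of_propositions`): the forms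
  are non-zero for large `n` (`S_{σ(n)} ≠ 0`, `Ŝ/S → −1`, `2^m − 1 + 1 ≠ 0`), bounded by `(2^m + 1) e^{c σ(n)}` with
  `c = 70 − 3δ − κ + 5ε < 0` (`ε = 1/2000`, using only `κ > 66.17`, `δ > 1.2956` and `d_n ≤ e^{(1+ε)n}`), and the
  tree's criterion `Literature.NumberTheory.Transcendental.exists_irrational_of_integerLinearForms` concludes.
* **Theorem 1.** "There exist at least two irrational numbers amongst the odd zeta values `ζ(5), ζ(7), …, ζ(69)`."
  NAMED FACT `theorem1` (`ζ(j) = zetaValue j` of `PeriodsWave0`). **Theorem 2** ("For any integer `m` such that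
  `1 ≤ m ≤ 33`, there exists at least one irrational number amongst the `ζ(2n+3)`, `n ∈ {1, …, 33} ∖ {m}`") is its
  equivalent form; the equivalence (§1) is PROVED: `theorem1_iff_theorem2`.

Transcription checked by exact rational computation (this session, `scratch/rz2020_check.py`): for
`(A, n) = (16,0), (16,2), (18,2), (16,4)` the partial fractions (2)–(3) of `rfun`, the symmetry
`p_{j,m} = (−1)^{j+1} p_{j,n−m}`, `Σ_m p_{1,m} = 0`, and the identities (6), (7) with the `q`'s (8), (10), (11) (to 28
digits against `Σ_{k≤400} R''(k)`, `Σ_{k≤400} R''(k−½)`); for `(16,2), (16,4), (18,6), (16,10)` the integrality (ii)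
(`Φ_10 = 7`).

Earlier results quoted in §1 and held by the tree: one of `ζ(5), …, ζ(11)` is irrational (Zudilin 2001;
`Literature/NumberTheory/Transcendental/ZudilinOddZeta.lean`), infinitely many odd zeta values are irrational
(`Literature.NumberTheory.Transcendental.infinite_setOf_irrational_zetaValue_odd_holds`). The later record
"two of `ζ(5), …, ζ(35)`" (Lai–Zhou 2022) is the tree's named fact
`Literature.NumberTheory.Irrationality.LaiZhou2022.twoOf_zeta5_to_zeta35`, from which that file derives the statement
of Theorem 1 (`rivoalZudilin2020_of_laiZhou`); `theorem1_iff_exists_pair` / `theorem1_of_laiZhou` link the two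
typings.
-/

open Finset Filter Topology
open scoped Nat

noncomputable section

namespace Literature.NumberTheory.Irrationality.RivoalZudilin2020

open Literature.NumberTheory.Transcendental (zetaValue)

/-! ## §2: the rational function `R`, its coefficients, the series `S_n`, `Ŝ_n` -/

/-- The rational function of §2:
`R(t) = n!^{A−15} 2^{18n} (2t+n) (t−n)_n^3 (t+n+1)_n^3 (t−n+½)_{3n}^3 / (t)_{n+1}^A`
(for `A ≥ 15`; Mathlib's junk value at the poles `t = 0, −1, …, −n`, never used).
[cite: RivoalZudilin2020, §2] -/
def rfun (A n : ℕ) (t : ℝ) : ℝ :=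
  (n ! : ℝ) ^ (A - 15) * 2 ^ (18 * n) * (2 * t + n) *
      ((∏ i ∈ range n, (t - n + i)) ^ 3 * (∏ i ∈ range n, (t + n + 1 + i)) ^ 3 *
        (∏ i ∈ range (3 * n), (t - n + 1 / 2 + i)) ^ 3) /
    ∏ k ∈ range (n + 1), (t + k) ^ A

/-- `R(t)(t+m)^A` with the pole at `t = −m` cancelled (`0 ≤ m ≤ n`), the function differentiated in (3).
[cite: RivoalZudilin2020, §2 (3)] -/
def rfunReg (A n m : ℕ) (t : ℝ) : ℝ :=
  (n ! : ℝ) ^ (A - 15) * 2 ^ (18 * n) * (2 * t + n) *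
      ((∏ i ∈ range n, (t - n + i)) ^ 3 * (∏ i ∈ range n, (t + n + 1 + i)) ^ 3 *
        (∏ i ∈ range (3 * n), (t - n + 1 / 2 + i)) ^ 3) /
    ∏ k ∈ (range (n + 1)).erase m, (t + k) ^ A

/-- The partial-fraction coefficients (3): `p_{j,m} = (1/(A−j)!) (d/dt)^{A−j} (R(t)(t+m)^A) |_{t=−m}`.
[cite: RivoalZudilin2020, §2 (3)] -/
def pCoeff (A n j m : ℕ) : ℝ :=
  1 / ((A - j)! : ℝ) * iteratedDeriv (A - j) (rfunReg A n m) (-(m : ℝ))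

/-- `S_n = Σ_{k≥1} R''(k)`. [cite: RivoalZudilin2020, §2] -/
def S (A n : ℕ) : ℝ := ∑' k : ℕ, iteratedDeriv 2 (rfun A n) ((k : ℝ) + 1)

/-- `Ŝ_n = Σ_{k≥1} R''(k − ½)`. [cite: RivoalZudilin2020, §2] -/
def Shat (A n : ℕ) : ℝ := ∑' k : ℕ, iteratedDeriv 2 (rfun A n) ((k : ℝ) + 1 / 2)

/-! ## §3: the linear forms (Proposition 1) -/

/-- `q_{j,n} = Σ_{m=0}^{n} (j−2)(j−1) p_{j−2,m}` for odd `j ≥ 5` (10). [cite: RivoalZudilin2020, §3 (10)] -/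
def qCoeff (A n j : ℕ) : ℝ :=
  ∑ m ∈ range (n + 1), ((j : ℝ) - 2) * ((j : ℝ) - 1) * pCoeff A n (j - 2) m

/-- `q_{0,n} = −Σ_{j=1}^{A} Σ_{m=0}^{n} Σ_{k=1}^{m} j(j+1) p_{j,m}/k^{j+2}` (11).
[cite: RivoalZudilin2020, §3 (11)] -/
def qZero (A n : ℕ) : ℝ :=
  -∑ j ∈ Icc 1 A, ∑ m ∈ range (n + 1), ∑ k ∈ Icc 1 m,
    (j : ℝ) * ((j : ℝ) + 1) * pCoeff A n j m / (k : ℝ) ^ (j + 2)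

/-- `q̂_{0,n} = −Σ_{j=1}^{A} Σ_{m=0}^{n} Σ_{k=1}^{m} j(j+1) p_{j,m}/(k − ½)^{j+2}` (8).
[cite: RivoalZudilin2020, §3 (8)] -/
def qZeroHat (A n : ℕ) : ℝ :=
  -∑ j ∈ Icc 1 A, ∑ m ∈ range (n + 1), ∑ k ∈ Icc 1 m,
    (j : ℝ) * ((j : ℝ) + 1) * pCoeff A n j m / ((k : ℝ) - 1 / 2) ^ (j + 2)

/-- `ρ(x, y) = ⌊2x+2y⌋ + ⌊4x−2y⌋ − 6⌊y⌋ − 6⌊x−y⌋`. [cite: RivoalZudilin2020, §3 proof of Proposition 1] -/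
def rho (x y : ℝ) : ℤ := ⌊2 * x + 2 * y⌋ + ⌊4 * x - 2 * y⌋ - 6 * ⌊y⌋ - 6 * ⌊x - y⌋

/-- `ρ₀(x) = min_y ρ(x, y)`, typed by its printed explicit form: the `1`-periodic step function equal to
`0, 1, 2, 3, 4` on `[0,⅓), [⅓,½), [½,⅔), [⅔,⅚), [⅚,1)`. [cite: RivoalZudilin2020, §3 proof of Proposition 1] -/
def rho0 (x : ℝ) : ℕ :=
  if Int.fract x < 1 / 3 then 0
  else if Int.fract x < 1 / 2 then 1
  else if Int.fract x < 2 / 3 then 2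
  else if Int.fract x < 5 / 6 then 3
  else 4

/-- `Φ_n = Π_{2√n < p ≤ n} p^{ρ₀(n/p)}` (product over primes; `2√n < p ⇔ 4n < p²`).
[cite: RivoalZudilin2020, §3 (Phi_n)] -/
def Phi (n : ℕ) : ℕ :=
  ∏ p ∈ (Ioc 0 n).filter (fun p => p.Prime ∧ 4 * n < p * p), p ^ rho0 ((n : ℝ) / p)

/-- The odd integers `j` with `5 ≤ j ≤ A + 1`, the index set of the linear forms (6), (7).
[cite: RivoalZudilin2020, §3 (6)] -/
def oddRange (A : ℕ) : Finset ℕ := (Icc 5 (A + 1)).filter Odd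

/-- **Proposition 1 (i)** (Rivoal–Zudilin 2020). For `A ≥ 16` and `n ≥ 0` both even,
`S_n = q_{0,n} + Σ_{j odd, 5≤j≤A+1} q_{j,n} ζ(j)` (6) and
`Ŝ_n = q̂_{0,n} + Σ_{j odd, 5≤j≤A+1} q_{j,n} (2^j − 1) ζ(j)` (7), with the explicit `q`'s (8), (10), (11) of the
proof. [cite: RivoalZudilin2020, Proposition 1 (i)] -/
def proposition1_i : Prop :=
  ∀ A n : ℕ, 16 ≤ A → Even A → Even n →
    S A n = qZero A n + ∑ j ∈ oddRange A, qCoeff A n j * zetaValue j ∧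
      Shat A n = qZeroHat A n + ∑ j ∈ oddRange A, qCoeff A n j * (2 ^ j - 1) * zetaValue j

/-- **Proposition 1 (ii)** (Rivoal–Zudilin 2020). For `A ≥ 16` and `n ≥ 0` both even, `Φ_n^{−3} d_n^{A+2}`
(`d_n = lcm(1, …, n) = Nat.lcmUpto n`) is a common denominator of `q_{0,n}`, `q̂_{0,n}` and the `q_{j,n}`, `j` odd,
`5 ≤ j ≤ A + 1`. [cite: RivoalZudilin2020, Proposition 1 (ii)] -/
def proposition1_ii : Prop :=
  ∀ A n : ℕ, 16 ≤ A → Even A → Even n →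
    (∃ z : ℤ, (Nat.lcmUpto n : ℝ) ^ (A + 2) / (Phi n : ℝ) ^ 3 * qZero A n = z) ∧
      (∃ z : ℤ, (Nat.lcmUpto n : ℝ) ^ (A + 2) / (Phi n : ℝ) ^ 3 * qZeroHat A n = z) ∧
      ∀ j ∈ oddRange A, ∃ z : ℤ, (Nat.lcmUpto n : ℝ) ^ (A + 2) / (Phi n : ℝ) ^ 3 * qCoeff A n j = z

/-- `ζ̂(s) := Σ_{k≥1} (k − ½)^{−s} = (2^s − 1) ζ(s)` for `s ≥ 2`.
[cite: RivoalZudilin2020, §3 proof of Proposition 1] -/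
theorem zetaHat_eq {s : ℕ} (hs : 2 ≤ s) :
    ∑' k : ℕ, 1 / ((k : ℝ) + 1 / 2) ^ s = (2 ^ s - 1) * zetaValue s := by
  -- `ζ(s) = Σ_k 1/(2k)^s + Σ_k 1/(2k+1)^s`, `Σ_k 1/(2k)^s = 2^{−s} ζ(s)` and `Σ_k 1/(2k+1)^s = 2^{−s} ζ̂(s)`
  have h2 : (2 : ℝ) ^ s ≠ 0 := pow_ne_zero _ two_ne_zero
  have hsum : Summable fun n : ℕ => 1 / (n : ℝ) ^ s := Real.summable_one_div_nat_pow.mpr (by omega)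
  have hinj2 : Function.Injective fun k : ℕ => 2 * k := fun a b h => by simpa using h
  have hinj2' : Function.Injective fun k : ℕ => 2 * k + 1 := fun a b h => by simpa using h
  have he : Summable fun k : ℕ => 1 / ((2 * k : ℕ) : ℝ) ^ s := hsum.comp_injective hinj2
  have ho : Summable fun k : ℕ => 1 / ((2 * k + 1 : ℕ) : ℝ) ^ s := hsum.comp_injective hinj2'
  have hsplit : ∑' k : ℕ, 1 / ((2 * k : ℕ) : ℝ) ^ s + ∑' k : ℕ, 1 / ((2 * k + 1 : ℕ) : ℝ) ^ s =
      zetaValue s := by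
    rw [zetaValue]
    exact tsum_even_add_odd (f := fun n : ℕ => 1 / (n : ℝ) ^ s) he ho
  have heven : ∑' k : ℕ, 1 / ((2 * k : ℕ) : ℝ) ^ s = (2 ^ s)⁻¹ * zetaValue s := by
    rw [zetaValue, ← tsum_mul_left]
    refine tsum_congr fun k => ?_
    rw [Nat.cast_mul, Nat.cast_two, mul_pow, one_div, mul_inv, one_div]
  have hodd : ∑' k : ℕ, 1 / ((2 * k + 1 : ℕ) : ℝ) ^ s = (2 ^ s)⁻¹ * ∑' k : ℕ, 1 / ((k : ℝ) + 1 / 2) ^ s := by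
    rw [← tsum_mul_left]
    refine tsum_congr fun k => ?_
    rw [Nat.cast_add, Nat.cast_mul, Nat.cast_two, Nat.cast_one,
      show (2 : ℝ) * k + 1 = 2 * ((k : ℝ) + 1 / 2) by ring, mul_pow]
    field_simp
  rw [heven, hodd] at hsplit
  have key : ∑' k : ℕ, 1 / ((k : ℝ) + 1 / 2) ^ s = 2 ^ s * zetaValue s - zetaValue s := by
    have h3 := congrArg (fun x => (2 : ℝ) ^ s * x) hsplit
    simp only [mul_add, mul_inv_cancel_left₀ h2] at h3
    linarith
  rw [key]
  ring

/-! ## §5–§6: asymptotics and the arithmetic of `Φ_n` -/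

/-- **Proposition 3** (Rivoal–Zudilin 2020; `A = 68`). There is an increasing sequence of even integers `σ(n)` with
`lim |S_{σ(n)}|^{1/σ(n)} = lim |Ŝ_{σ(n)}|^{1/σ(n)} = e^{−κ}`, `κ ≈ 66.1727` (typed: `66.17 < κ < 66.18`), and
`lim Ŝ_{σ(n)}/S_{σ(n)} = −1`. [cite: RivoalZudilin2020, Proposition 3] -/
def proposition3 : Prop :=
  ∃ σ : ℕ → ℕ, StrictMono σ ∧ (∀ n, Even (σ n)) ∧ ∃ κ : ℝ, 66.17 < κ ∧ κ < 66.18 ∧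
    Tendsto (fun n => |S 68 (σ n)| ^ (1 / (σ n : ℝ))) atTop (𝓝 (Real.exp (-κ))) ∧
      Tendsto (fun n => |Shat 68 (σ n)| ^ (1 / (σ n : ℝ))) atTop (𝓝 (Real.exp (-κ))) ∧
      Tendsto (fun n => Shat 68 (σ n) / S 68 (σ n)) atTop (𝓝 (-1))

/-- **§6, asymptotics of `Φ_n`** (prime number theorem): `δ := lim_n log(Φ_n)/n` exists,
`δ = ∫₀¹ ρ₀(t) d(ψ(t) + t^{−1}) ≈ 1.29564` (typed: the limit exists and `1.2956 < δ < 1.2957`; the digamma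
integral is not typed). [cite: RivoalZudilin2020, §6] -/
def log_phi_div_tendsto : Prop :=
  ∃ δ : ℝ, 1.2956 < δ ∧ δ < 1.2957 ∧ Tendsto (fun n : ℕ => Real.log (Phi n) / n) atTop (𝓝 δ)

/-! ## Theorems 1 and 2 -/

/-- **Theorem 1** (Rivoal–Zudilin 2020). There exist at least two irrational numbers amongst the 33 odd zeta values
`ζ(5), ζ(7), …, ζ(69)`. [cite: RivoalZudilin2020, Theorem 1] -/
def theorem1 : Prop :=
  ∃ i ∈ oddRange 68, ∃ j ∈ oddRange 68, i ≠ j ∧ Irrational (zetaValue i) ∧ Irrational (zetaValue j)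

/-- **Theorem 2 ⇔ Theorem 1** (Rivoal–Zudilin 2020, §1). Theorem 1 is equivalent to: for every integer `m` with
`1 ≤ m ≤ 33` there is at least one irrational number amongst the `ζ(2n+3)`, `n ∈ {1, …, 33} ∖ {m}` (Theorem 2).
PROVED as in §1 (apply Theorem 2 with `m = 1`, then with the index found).
[cite: RivoalZudilin2020, Theorem 2 and §1] -/
theorem theorem1_iff_theorem2 :
    theorem1 ↔ ∀ m ∈ Icc 1 33, ∃ n ∈ Icc 1 33, n ≠ m ∧ Irrational (zetaValue (2 * n + 3)) := by
  have hmem : ∀ i, i ∈ oddRange 68 ↔ ∃ n ∈ Icc 1 33, i = 2 * n + 3 := fun i => by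
    simp only [oddRange, mem_filter, mem_Icc]
    constructor
    · rintro ⟨⟨h5, h69⟩, ⟨k, rfl⟩⟩
      exact ⟨k - 1, ⟨by omega, by omega⟩, by omega⟩
    · rintro ⟨n, ⟨h1, h33⟩, rfl⟩
      exact ⟨⟨by omega, by omega⟩, ⟨n + 1, by ring⟩⟩
  constructor
  · rintro ⟨i, hi, j, hj, hij, hirr, hjrr⟩ m hm
    obtain ⟨a, ha, rfl⟩ := (hmem i).1 hi
    obtain ⟨b, hb, rfl⟩ := (hmem j).1 hj
    by_cases ham : a = m
    · exact ⟨b, hb, fun h => hij (by rw [ham, h]), hjrr⟩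
    · exact ⟨a, ha, ham, hirr⟩
  · intro h
    obtain ⟨a, ha, ha1, hirr⟩ := h 1 (by simp)
    obtain ⟨b, hb, hba, hjrr⟩ := h a ha
    exact ⟨2 * a + 3, (hmem _).2 ⟨a, ha, rfl⟩, 2 * b + 3, (hmem _).2 ⟨b, hb, rfl⟩, by omega, hirr, hjrr⟩

/-! ## §6: Theorem 2 (hence Theorem 1) from Propositions 1, 3 and the growth of `d_n`, `Φ_n` -/

/-- `Φ_n ≥ 1` (a product of prime powers). [cite: RivoalZudilin2020, §3 (Phi_n)] -/
theorem Phi_pos (n : ℕ) : 0 < Phi n := by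
  unfold Phi
  exact prod_pos fun p hp => pow_pos (mem_filter.1 hp).2.1.pos _

/-- **§6 of [RZ2020], PROVED from the typed Propositions**: Proposition 1 (i), (ii) at `A = 68`, Proposition 3, the
limit `δ = lim log(Φ_n)/n > 1.2956` and the prime number theorem `d_n ≤ e^{(1+ε)n}` (tree:
`Literature.NumberTheory.Transcendental.eventually_lcmUpto_mul_pow_le_exp`) give Theorem 2: for odd
`m ∈ {5, …, 69}` the integer linear forms
`Φ_n^{−3} d_n^{70} ((2^m − 1) S_n − Ŝ_n) = Q_{0,n} + Σ_{j odd ≠ m} Q_{j,n} ζ(j)` along `σ` are non-zero and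
`O(e^{(70 − κ − 3δ + o(1)) σ(n)}) → 0`, so some `ζ(j)`, `j ≠ m`, is irrational
(criterion `Literature.NumberTheory.Transcendental.exists_irrational_of_integerLinearForms`).
[cite: RivoalZudilin2020, §6] -/
theorem theorem2_of_propositions (h1 : proposition1_i) (h2 : proposition1_ii) (h3 : proposition3)
    (h4 : log_phi_div_tendsto) :
    ∀ m ∈ Icc 1 33, ∃ n ∈ Icc 1 33, n ≠ m ∧ Irrational (zetaValue (2 * n + 3)) := by
  intro m₀ hm₀
  rw [mem_Icc] at hm₀
  obtain ⟨σ, hσ, hσev, κ, hκ, -, hS, -, hrat⟩ := h3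
  obtain ⟨δ, hδ, -, hΦ⟩ := h4
  set m : ℕ := 2 * m₀ + 3 with hm
  have hm5 : 5 ≤ m := by omega
  set T : Finset ℕ := (oddRange 68).erase m with hT
  -- the integers of Proposition 1 (ii) at `A = 68` along `σ`
  have h68 : (16 : ℕ) ≤ 68 := by norm_num
  have h68e : Even (68 : ℕ) := by decide
  choose z0 hz0 using fun k => (h2 68 (σ k) h68 h68e (hσev k)).1
  choose z0h hz0h using fun k => (h2 68 (σ k) h68 h68e (hσev k)).2.1
  choose z hz using fun k => (h2 68 (σ k) h68 h68e (hσev k)).2.2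
  -- `D_k = d_{σ(k)}^{70} / Φ_{σ(k)}^3` and the linear forms `ℓ_k = D_k ((2^m − 1) S_{σ(k)} − Ŝ_{σ(k)})`
  set D : ℕ → ℝ := fun k => (Nat.lcmUpto (σ k) : ℝ) ^ (68 + 2) / (Phi (σ k) : ℝ) ^ 3 with hD
  set ℓ : ℕ → ℝ := fun k => D k * ((2 ^ m - 1) * S 68 (σ k) - Shat 68 (σ k)) with hℓ
  have hDpos : ∀ k, 0 < D k := fun k => by
    have h1' : (0 : ℝ) < Nat.lcmUpto (σ k) := by exact_mod_cast Nat.lcmUpto_pos _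
    have h2' : (0 : ℝ) < Phi (σ k) := by exact_mod_cast Phi_pos _
    positivity
  -- (a) the `ℓ_k` are integer linear forms in the `ζ(j)`, `j ∈ T`
  have hrep : ∀ k, ℓ k = ((((2 : ℤ) ^ m - 1) * z0 k - z0h k : ℤ) : ℝ) +
      ∑ i : T, ((((2 : ℤ) ^ m - 2 ^ (i : ℕ)) * z k i (mem_of_mem_erase i.2) : ℤ) : ℝ) * zetaValue i := by
    intro k
    obtain ⟨hSk, hShk⟩ := h1 68 (σ k) h68 h68e (hσev k)
    have step1 : ℓ k = ((2 ^ m - 1) * (D k * qZero 68 (σ k)) - D k * qZeroHat 68 (σ k)) +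
        ∑ j ∈ oddRange 68, (2 ^ m - 2 ^ j) * (D k * qCoeff 68 (σ k) j) * zetaValue j := by
      have e1 : ∑ j ∈ oddRange 68, (2 ^ m - 2 ^ j) * (D k * qCoeff 68 (σ k) j) * zetaValue j =
          D k * ((2 ^ m - 1) * ∑ j ∈ oddRange 68, qCoeff 68 (σ k) j * zetaValue j -
            ∑ j ∈ oddRange 68, qCoeff 68 (σ k) j * (2 ^ j - 1) * zetaValue j) := by
        rw [mul_sum, ← sum_sub_distrib, mul_sum]
        exact sum_congr rfl fun j _ => by ring
      rw [e1, hℓ]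
      simp only
      rw [hSk, hShk]
      ring
    rw [step1, hz0 k, hz0h k]
    have hm0 : ((2 : ℝ) ^ m - 2 ^ m) * (D k * qCoeff 68 (σ k) m) * zetaValue m = 0 := by ring
    rw [← sum_erase (oddRange 68) hm0, ← sum_coe_sort]
    push_cast
    congr 1
    exact Fintype.sum_congr _ _ fun i => by rw [hz k i (mem_of_mem_erase i.2)]
  -- (b) asymptotics: `ℓ_k → 0`
  have hσtop : Tendsto σ atTop atTop := hσ.tendsto_atTop
  have hσR : Tendsto (fun k => (σ k : ℝ)) atTop atTop := tendsto_natCast_atTop_atTop.comp hσtop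
  set ε : ℝ := 1 / 2000 with hε
  have hε0 : 0 < ε := by norm_num [hε]
  -- `S_{σ(k)} ≠ 0` and `|S_{σ(k)}| ≤ e^{(−κ+ε)σ(k)}` eventually
  have hS1 : ∀ᶠ k in atTop, |S 68 (σ k)| ^ (1 / (σ k : ℝ)) < Real.exp (-κ + ε) :=
    hS.eventually (gt_mem_nhds (Real.exp_lt_exp.2 (by linarith)))
  have hS2 : ∀ᶠ k in atTop, Real.exp (-κ) / 2 < |S 68 (σ k)| ^ (1 / (σ k : ℝ)) :=
    hS.eventually (lt_mem_nhds (by linarith [Real.exp_pos (-κ)]))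
  have hSb : ∀ᶠ k in atTop, S 68 (σ k) ≠ 0 ∧ |S 68 (σ k)| ≤ Real.exp ((-κ + ε) * σ k) := by
    filter_upwards [hS1, hS2, hσtop.eventually (eventually_ge_atTop 1)] with k hk1 hk2 hk3
    have hne : S 68 (σ k) ≠ 0 := by
      intro h0
      rw [h0, abs_zero, Real.zero_rpow (by positivity)] at hk2
      linarith [Real.exp_pos (-κ)]
    refine ⟨hne, ?_⟩
    have h0 : 0 ≤ |S 68 (σ k)| ^ (1 / (σ k : ℝ)) := by positivity
    calc |S 68 (σ k)| = (|S 68 (σ k)| ^ (1 / (σ k : ℝ))) ^ (σ k) := by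
          rw [one_div, Real.rpow_inv_natCast_pow (abs_nonneg _) (by omega)]
      _ ≤ Real.exp (-κ + ε) ^ (σ k) := pow_le_pow_left₀ h0 hk1.le _
      _ = Real.exp ((-κ + ε) * σ k) := by rw [← Real.exp_nat_mul]; ring_nf
  -- `|Ŝ/S| < 2` eventually
  have hR : ∀ᶠ k in atTop, |Shat 68 (σ k) / S 68 (σ k)| < 2 := by
    filter_upwards [Metric.tendsto_nhds.1 hrat 1 one_pos] with k hk
    rw [Real.dist_eq] at hk
    calc |Shat 68 (σ k) / S 68 (σ k)| = |(Shat 68 (σ k) / S 68 (σ k) - -1) + -1| := by ring_nf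
      _ ≤ |Shat 68 (σ k) / S 68 (σ k) - -1| + |(-1 : ℝ)| := abs_add_le _ _
      _ < 2 := by rw [abs_neg, abs_one]; linarith
  -- `Φ_{σ(k)} ≥ e^{(δ−ε)σ(k)}` eventually
  have hΦ1 : ∀ᶠ n : ℕ in atTop, Real.exp ((δ - ε) * n) < Phi n := by
    filter_upwards [hΦ.eventually (lt_mem_nhds (by linarith : δ - ε < δ)), eventually_ge_atTop 1]
      with n hn hn1
    have hpos : (0 : ℝ) < Phi n := by exact_mod_cast Phi_pos n
    rw [← Real.lt_log_iff_exp_lt hpos]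
    have hn0 : (0 : ℝ) < n := by exact_mod_cast hn1
    rwa [lt_div_iff₀ hn0] at hn
  -- `d_{σ(k)}^{70} ≤ e^{(70+ε)σ(k)}` eventually (prime number theorem)
  have hd1 : ∀ᶠ n : ℕ in atTop, (Nat.lcmUpto n : ℝ) ^ (68 + 2) ≤ Real.exp ((70 + ε) * n) := by
    filter_upwards [Literature.NumberTheory.Transcendental.eventually_lcmUpto_mul_pow_le_exp 1 70 hε0] with n hn
    simpa [one_mul] using hn
  -- the bound `|ℓ_k| ≤ (2^m + 1) e^{c σ(k)}` with `c = 70 − 3δ − κ + 5ε < 0`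
  set c : ℝ := 70 - 3 * δ - κ + 5 * ε with hc
  have hc0 : c < 0 := by rw [hc, hε]; linarith
  have hbound : ∀ᶠ k in atTop, ‖ℓ k‖ ≤ (2 ^ m + 1) * Real.exp (c * σ k) := by
    filter_upwards [hSb, hR, hσtop.eventually hΦ1, hσtop.eventually hd1] with k ⟨hne, hSk⟩ hRk hΦk hdk
    rw [Real.norm_eq_abs, hℓ]
    simp only
    have hfac : (2 ^ m - 1) * S 68 (σ k) - Shat 68 (σ k) =
        S 68 (σ k) * ((2 ^ m - 1) - Shat 68 (σ k) / S 68 (σ k)) := by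
      field_simp
    have hr : |(2 : ℝ) ^ m - 1 - Shat 68 (σ k) / S 68 (σ k)| ≤ 2 ^ m + 1 := by
      calc |(2 : ℝ) ^ m - 1 - Shat 68 (σ k) / S 68 (σ k)|
          ≤ |(2 : ℝ) ^ m - 1| + |Shat 68 (σ k) / S 68 (σ k)| := abs_sub _ _
        _ ≤ (2 ^ m - 1) + 2 := by
            rw [abs_of_nonneg (by linarith [one_le_pow₀ (M₀ := ℝ) one_le_two (n := m)])]
            linarith
        _ = 2 ^ m + 1 := by ring
    have hΦ3 : Real.exp ((δ - ε) * σ k) ^ 3 ≤ (Phi (σ k) : ℝ) ^ 3 :=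
      pow_le_pow_left₀ (Real.exp_pos _).le hΦk.le 3
    have hDk : D k ≤ Real.exp ((70 + ε) * σ k) / Real.exp ((δ - ε) * σ k) ^ 3 := by
      rw [hD]
      simp only
      gcongr
    rw [hfac, abs_mul, abs_mul, abs_of_pos (hDpos k)]
    calc D k * (|S 68 (σ k)| * |2 ^ m - 1 - Shat 68 (σ k) / S 68 (σ k)|)
        ≤ (Real.exp ((70 + ε) * σ k) / Real.exp ((δ - ε) * σ k) ^ 3) *
            (Real.exp ((-κ + ε) * σ k) * (2 ^ m + 1)) := by gcongr
      _ = (2 ^ m + 1) * (Real.exp ((70 + ε) * σ k - (3 : ℕ) * ((δ - ε) * σ k)) *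
            Real.exp ((-κ + ε) * σ k)) := by
          rw [← Real.exp_nat_mul, ← Real.exp_sub]; ring
      _ = (2 ^ m + 1) * Real.exp (c * σ k) := by
          rw [← Real.exp_add]; congr 1; rw [hc]; push_cast; ring
  have hsmall : Tendsto ℓ atTop (𝓝 0) := by
    refine squeeze_zero_norm' hbound ?_
    have h := (Real.tendsto_exp_atBot.comp (hσR.const_mul_atTop_of_neg hc0)).const_mul ((2 : ℝ) ^ m + 1)
    simpa using h
  -- (c) `ℓ_k ≠ 0` eventually
  have hne : ∃ᶠ k in atTop, ℓ k ≠ 0 := by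
    refine Filter.Eventually.frequently ?_
    filter_upwards [hSb, hR] with k ⟨hne, _hSk⟩ hRk
    rw [hℓ]
    simp only
    have hfac : (2 ^ m - 1) * S 68 (σ k) - Shat 68 (σ k) =
        S 68 (σ k) * ((2 ^ m - 1) - Shat 68 (σ k) / S 68 (σ k)) := by
      field_simp
    have h32 : (32 : ℝ) ≤ 2 ^ m := by
      calc (32 : ℝ) = 2 ^ 5 := by norm_num
        _ ≤ 2 ^ m := pow_le_pow_right₀ one_le_two hm5
    have hr : (2 : ℝ) ^ m - 1 - Shat 68 (σ k) / S 68 (σ k) ≠ 0 := by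
      have := (abs_lt.1 hRk).2
      linarith
    rw [hfac]
    exact mul_ne_zero (hDpos k).ne' (mul_ne_zero hne hr)
  -- the criterion
  obtain ⟨i, hi⟩ := Literature.NumberTheory.Transcendental.exists_irrational_of_integerLinearForms
    (fun i : T => zetaValue i) ℓ _ _ hrep hsmall hne
  have hiT := i.2
  simp only [hT, mem_erase, oddRange, mem_filter, mem_Icc] at hiT
  obtain ⟨him, ⟨h5, h69⟩, ⟨a, ha⟩⟩ := hiT
  refine ⟨a - 1, ?_, ?_, ?_⟩
  · rw [mem_Icc]; omega
  · omega
  · have : 2 * (a - 1) + 3 = (i : ℕ) := by omega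
    rw [this]
    exact hi

/-- `theorem1` in the shape used by the tree's record file `LaiZhou2022/OddZetaAndBetaRecords.lean`
(`Literature.NumberTheory.Irrationality.LaiZhou2022.rivoalZudilin2020_of_laiZhou`).
[cite: RivoalZudilin2020, Theorem 1] -/
theorem theorem1_iff_exists_pair :
    theorem1 ↔ ∃ i j : ℕ, i ≠ j ∧ Odd i ∧ Odd j ∧ 5 ≤ i ∧ i ≤ 69 ∧ 5 ≤ j ∧ j ≤ 69 ∧
      Irrational (zetaValue i) ∧ Irrational (zetaValue j) := by
  simp only [theorem1, oddRange, mem_filter, mem_Icc, Nat.reduceAdd]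
  constructor
  · rintro ⟨i, ⟨⟨hi5, hi69⟩, hio⟩, j, ⟨⟨hj5, hj69⟩, hjo⟩, hij, hi, hj⟩
    exact ⟨i, j, hij, hio, hjo, hi5, hi69, hj5, hj69, hi, hj⟩
  · rintro ⟨i, j, hij, hio, hjo, hi5, hi69, hj5, hj69, hi, hj⟩
    exact ⟨i, ⟨⟨hi5, hi69⟩, hio⟩, j, ⟨⟨hj5, hj69⟩, hjo⟩, hij, hi, hj⟩

/-- Theorem 1 also follows from the later record "two of `ζ(5), …, ζ(35)`" of Lai–Zhou (2022), a named fact of the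
tree. [cite: RivoalZudilin2020, Theorem 1] -/
theorem theorem1_of_laiZhou (h : LaiZhou2022.twoOf_zeta5_to_zeta35) : theorem1 :=
  theorem1_iff_exists_pair.2 (LaiZhou2022.rivoalZudilin2020_of_laiZhou h)

/-- **Theorem 1 from the typed Propositions** (§6): `theorem2_of_propositions` and `theorem1_iff_theorem2`.
[cite: RivoalZudilin2020, §6] -/
theorem theorem1_of_propositions (h1 : proposition1_i) (h2 : proposition1_ii) (h3 : proposition3)
    (h4 : log_phi_div_tendsto) : theorem1 :=
  theorem1_iff_theorem2.2 (theorem2_of_propositions h1 h2 h3 h4)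

end Literature.NumberTheory.Irrationality.RivoalZudilin2020
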